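/-
Copyright (c) 2026 the pub-hodgecm-mathlib formalisation cell (harness21).  Prover seat hodgecm-mathlib-K2E3-p17 (g7), Track B «K2-LIT» ∕ h413
(`stmt-HodgeConjecture-24833`), line `K2_E3_EllipticInputs`, unit U12 §L, road «GL-[M6]-sc» (owner K2E3-p23 (g5)), MEMO «M6sc-BLUEPRINT v4» §2 brick T15-log
(SPLIT HALF), log corollary: «`1_{𝔤′_split} · ‖disc χ‖^{-1/2} · (1 + |log ‖disc χ‖|)^κ ∈ L¹_loc(𝔤𝔩₃(F))` for every `κ`».  2026-09-04.
-/
import Summits.HodgeConjecture.HodgeConjecture.Theorems.K2E3GL3SplitDiscriminantLocIntegrable   -- ★ p858251 (this seat): `locallyIntegrable_indicator_split_rpow_neg` (power form, `ε < 1/4`)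
import Mathlib.Analysis.SpecialFunctions.Pow.Real
import HarnessLib

/-!
# K2_E3 road (h413), §L — brick T15-log (split half), LOG FORM: `X ↦ 1_{𝔤′}(X) ‖disc χ_X‖^{-1/2} (1 + |log ‖disc χ_X‖|)^κ` is locally integrable on `𝔤𝔩₃(F)`

Cell `pub/hodgecm-mathlib` (D-0151), Track B, seat K2E3-p17 (g7); MEMO «M6sc-BLUEPRINT v4» (K2E3-p23 (g5)) §0.2 «LOG-ROOM: the weight is
`W = C_loc·|D♮|^{-1/2}(1 + |log|D♮|| + h)^κ` … T15 is needed (and proved) in the form `1_{non-ell reg}|D♮|^{-1/2}(1+|log|D♮||)^κ ∈ L¹_loc` for every `κ`»; this file is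
the split-class half of that statement ON THE LIE ALGEBRA, deduced from the power form ★ `K2E3GL3SplitDiscriminantLocIntegrable` (`ε = 1/8`).
`--supports stmt-HodgeConjecture-24833 --as helper`; THEOREMS ONLY (no definition ∕ instance ∕ notation ∕ named fact ∕ `sorry`); never imports `Cruxes/…/Lines`.  COUNT-NEUTRAL.

THE MATHEMATICS.  §1 (real analysis): for `κ : ℕ`, `ε > 0`, `T > 0` there is `C > 0` with `(1 + |log t|)^κ ≤ C · t^{-ε}` for all `0 < t ≤ T` (for `t ≤ 1`,
`|log t| < a⁻¹ t^{-a}` with `a = ε/(κ+1)`, Mathlib `Real.abs_log_mul_self_rpow_lt`; for `1 < t ≤ T` the left side is bounded and `t^{-ε} ≥ T^{-ε}`).  §2: on a compact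
`S ⊆ 𝔤𝔩₃(F)`, `‖disc χ_X‖` is bounded, so `1_{𝔤′}‖disc‖^{-1/2}(1+|log‖disc‖|)^κ ≤ C · 1_{𝔤′}‖disc‖^{-(1/2+1/8)}` on `S`, integrable there by ★ (power form).
[HarishChandra1970, Part V §6 Thm. 15, Part VII §3 pp. 71–73] [HarishChandra1999AdmissibleDistributions, §15]
HONEST LABEL: HC_CM is proved only modulo the 7 printed citations (2 remaining named inputs: hLiu418 = stmt-HodgeConjecture-24832, h413 = stmt-HodgeConjecture-24833)
until rung 0 closes; count-neutral helper.

## Mathlib ∕ tree search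
Tree: ★ `K2E3GL3SplitDiscriminantLocIntegrable.locallyIntegrable_indicator_split_rpow_neg`, ★ `isOpen_setOf_charpoly_discr_ne_zero_and_card_roots_eq`, ★ `continuous_discr_charpoly`,
★ `continuous_normAbs`.  Mathlib: `Real.abs_log_mul_self_rpow_lt`, `Real.rpow_le_rpow_of_exponent_ge`, `Real.rpow_le_rpow_of_nonpos`, `Real.rpow_natCast`, `Real.rpow_mul`,
`Real.rpow_add`, `Integrable.mono'`, `IsCompact.bddAbove_image`, `locallyIntegrable_iff`, `Real.measurable_log`.
Dedup: `rg "abs_log.*pow_le.*rpow_neg|log_pow_le_mul_rpow|mul_log_pow"` over Literature∕Summits — no hits for the real-analysis lemma in this form.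

## References
* [HarishChandra1970] Harish-Chandra (van Dijk), *Harmonic Analysis on Reductive p-adic Groups*, LNM 162 (1970), Part V §6 Thm. 15, Part VII §3.
* [HarishChandra1999AdmissibleDistributions] Harish-Chandra (DeBacker–Sally), *Admissible Invariant Distributions on Reductive p-adic Groups* (1999), §15.
-/

set_option autoImplicit false
set_option linter.dupNamespace false

noncomputable section

open MeasureTheory MeasureTheory.Measure Set Matrix Topology Polynomial Filter
open scoped MatrixGroups NNReal ENNReal
open Literature.NumberTheory.GaloisRepresentations Literature.NumberTheory.GaloisRepresentations.IsNonarchimedeanLocalField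
open Literature.NumberTheory.Automorphic Literature.NumberTheory.Automorphic.LocalFieldHaar
open Summit.HodgeConjecture.HodgeConjecture.Cruxes.H413.K2E3CubicRationalRootsLocallyConstant
open Summit.HodgeConjecture.HodgeConjecture.Cruxes.H413.K2E3GL3SplitDiscriminantLocIntegrable

namespace Summit.HodgeConjecture.HodgeConjecture.Cruxes.H413.K2E3GL3SplitDiscriminantLogLocIntegrable

/-! ## §1  `(1 + |log t|)^κ ≤ C · t^{-ε}` on `(0, T]` -/

/-- **Logarithms lose only an `ε` of a power**: for `κ : ℕ`, `ε > 0`, `T > 0` there is `C > 0` with `(1 + |log t|)^κ ≤ C · t^{-ε}` for `0 < t ≤ T`.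
[cite: HarishChandra1970, Part VII §3 p. 72] -/
theorem exists_one_add_abs_log_pow_le_mul_rpow_neg (κ : ℕ) {ε : ℝ} (hε : 0 < ε) {T : ℝ} (hT : 0 < T) :
    ∃ C : ℝ, 0 < C ∧ ∀ t : ℝ, 0 < t → t ≤ T → (1 + |Real.log t|) ^ κ ≤ C * t ^ (-ε) := by
  -- the small-`t` constant
  set a : ℝ := ε / (κ + 1) with ha
  have hκ1 : (0 : ℝ) < κ + 1 := by positivity
  have ha0 : 0 < a := div_pos hε hκ1
  have haκ : a * κ ≤ ε := by
    rw [ha, div_mul_eq_mul_div, div_le_iff₀ hκ1]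
    nlinarith
  set C₁ : ℝ := (1 + 1 / a) ^ κ with hC₁
  have hC₁0 : 0 < C₁ := by positivity
  -- the large-`t` constant
  set C₂ : ℝ := (1 + |Real.log T|) ^ κ * T ^ ε with hC₂
  have hC₂0 : 0 < C₂ := by positivity
  refine ⟨max C₁ C₂, lt_max_of_lt_left hC₁0, fun t ht htT => ?_⟩
  have htε : 0 < t ^ (-ε) := Real.rpow_pos_of_pos ht _
  rcases le_or_gt t 1 with ht1 | ht1
  · -- `t ≤ 1`: `|log t| < a⁻¹ t^{-a}`, `1 ≤ t^{-a}`
    have hkey := Real.abs_log_mul_self_rpow_lt t a ht ht1 ha0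
    have hta : 0 < t ^ a := Real.rpow_pos_of_pos ht _
    have hlog : |Real.log t| ≤ (1 / a) * t ^ (-a) := by
      rw [abs_mul, abs_of_pos hta] at hkey
      rw [Real.rpow_neg ht.le, ← div_eq_mul_inv, le_div_iff₀ hta]
      exact hkey.le
    have hone : (1 : ℝ) ≤ t ^ (-a) := by
      rw [Real.rpow_neg ht.le]
      exact one_le_inv_iff₀.2 ⟨hta, Real.rpow_le_one ht.le ht1 ha0.le⟩
    have hsum : 1 + |Real.log t| ≤ (1 + 1 / a) * t ^ (-a) := by nlinarith
    have hpow : (1 + |Real.log t|) ^ κ ≤ ((1 + 1 / a) * t ^ (-a)) ^ κ := pow_le_pow_left₀ (by positivity) hsum κ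
    have hexp : (t ^ (-a)) ^ κ ≤ t ^ (-ε) := by
      rw [← Real.rpow_natCast, ← Real.rpow_mul ht.le]
      exact Real.rpow_le_rpow_of_exponent_ge ht ht1 (by nlinarith)
    calc (1 + |Real.log t|) ^ κ ≤ ((1 + 1 / a) * t ^ (-a)) ^ κ := hpow
      _ = C₁ * (t ^ (-a)) ^ κ := by rw [mul_pow]
      _ ≤ C₁ * t ^ (-ε) := by gcongr
      _ ≤ max C₁ C₂ * t ^ (-ε) := by gcongr; exact le_max_left _ _
  · -- `1 < t ≤ T`: bounded numerator, `t^{-ε} ≥ T^{-ε}`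
    have hlogle : |Real.log t| ≤ |Real.log T| := by
      rw [abs_of_pos (Real.log_pos ht1), abs_of_pos (Real.log_pos (ht1.trans_le htT))]
      exact Real.log_le_log ht htT
    have hnum : (1 + |Real.log t|) ^ κ ≤ (1 + |Real.log T|) ^ κ := pow_le_pow_left₀ (by positivity) (by linarith) κ
    have hTε : T ^ (-ε) ≤ t ^ (-ε) := Real.rpow_le_rpow_of_nonpos ht htT (by linarith)
    have hTT : T ^ ε * T ^ (-ε) = 1 := by
      rw [← Real.rpow_add hT, add_neg_cancel, Real.rpow_zero]
    calc (1 + |Real.log t|) ^ κ ≤ (1 + |Real.log T|) ^ κ := hnum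
      _ = C₂ * T ^ (-ε) := by rw [hC₂, mul_assoc, hTT, mul_one]
      _ ≤ C₂ * t ^ (-ε) := by gcongr
      _ ≤ max C₁ C₂ * t ^ (-ε) := by gcongr; exact le_max_right _ _

/-! ## §2  The log form of T15 (split half) on `𝔤𝔩₃(F)` -/

variable {F : Type*} [Field F] [ValuativeRel F] [TopologicalSpace F] [IsNonarchimedeanLocalField F]
variable [MeasurableSpace (Matrix (Fin 3) (Fin 3) F)] [BorelSpace (Matrix (Fin 3) (Fin 3) F)]

/-- **T15-log, SPLIT HALF (log form): for every `κ : ℕ` and every additive Haar measure `μ𝔤` of `𝔤𝔩₃(F)`,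
`X ↦ 1[disc χ_X ≠ 0 ∧ χ_X has 3 roots in F] · ‖disc χ_X‖_F^{-1/2} · (1 + |log ‖disc χ_X‖_F|)^κ` is locally integrable** (★ power form at `ε = 1/8` + §1 on compacta).
[cite: HarishChandra1970, Part V §6 Thm. 15 p. 63, Part VII §3 pp. 71–73] [cite: HarishChandra1999AdmissibleDistributions, §15] -/
theorem locallyIntegrable_indicator_split_invSqrt_mul_log_pow (μ𝔤 : Measure (Matrix (Fin 3) (Fin 3) F)) [μ𝔤.IsAddHaarMeasure] (κ : ℕ) :
    LocallyIntegrable (fun X : Matrix (Fin 3) (Fin 3) F =>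
      {Y : Matrix (Fin 3) (Fin 3) F | Y.charpoly.discr ≠ 0 ∧ Y.charpoly.roots.card = 3}.indicator
        (fun Y => ((normAbs F Y.charpoly.discr : ℝ)) ^ (-(1 / 2 : ℝ)) * (1 + |Real.log (normAbs F Y.charpoly.discr : ℝ)|) ^ κ) X) μ𝔤 := by
  haveI : T2Space F := (isLocalField F).toT2Space
  haveI : LocallyCompactSpace F := (isLocalField F).toLocallyCompactSpace
  haveI : IsTopologicalRing F := inferInstance
  haveI : T2Space (Matrix (Fin 3) (Fin 3) F) := inferInstanceAs (T2Space (Fin 3 → Fin 3 → F))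
  haveI : LocallyCompactSpace (Matrix (Fin 3) (Fin 3) F) := Pi.locallyCompactSpace_of_finite
  letI : MeasurableSpace F := borel F
  haveI : BorelSpace F := ⟨rfl⟩
  set 𝔤' : Set (Matrix (Fin 3) (Fin 3) F) := {Y : Matrix (Fin 3) (Fin 3) F | Y.charpoly.discr ≠ 0 ∧ Y.charpoly.roots.card = 3} with h𝔤'
  have h𝔤'm : MeasurableSet 𝔤' := (isOpen_setOf_charpoly_discr_ne_zero_and_card_roots_eq 3).measurableSet
  have hdc : Continuous fun Y : Matrix (Fin 3) (Fin 3) F => (normAbs F Y.charpoly.discr : ℝ) :=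
    continuous_subtype_val.comp (continuous_normAbs.comp (F0P3cStCharTSHCDGroupToLie.continuous_discr_charpoly (K := F)))
  have hm : Measurable fun X : Matrix (Fin 3) (Fin 3) F => 𝔤'.indicator
      (fun Y => ((normAbs F Y.charpoly.discr : ℝ)) ^ (-(1 / 2 : ℝ)) * (1 + |Real.log (normAbs F Y.charpoly.discr : ℝ)|) ^ κ) X :=
    ((hdc.measurable.pow_const _).mul (((Real.measurable_log.comp hdc.measurable).abs.const_add _).pow_const _)).indicator h𝔤'm
  refine (locallyIntegrable_iff).2 fun S hS => ?_
  -- the bound `‖disc χ‖ ≤ T` on `S` and the constant of §1 at `ε = 1/8`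
  obtain ⟨T₀, hT₀⟩ := hS.bddAbove_image hdc.continuousOn
  set T : ℝ := max T₀ 1 with hT
  have hT0 : 0 < T := lt_max_of_lt_right one_pos
  have hle : ∀ X ∈ S, (normAbs F X.charpoly.discr : ℝ) ≤ T := fun X hX => (hT₀ ⟨X, hX, rfl⟩).trans (le_max_left _ _)
  obtain ⟨C, hC0, hC⟩ := exists_one_add_abs_log_pow_le_mul_rpow_neg κ (by norm_num : (0 : ℝ) < 1 / 8) hT0
  -- the dominating function
  have hdom : IntegrableOn (fun X : Matrix (Fin 3) (Fin 3) F => C * 𝔤'.indicator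
      (fun Y => ((normAbs F Y.charpoly.discr : ℝ)) ^ (-(1 / 2 + 1 / 8 : ℝ))) X) S μ𝔤 :=
    ((locallyIntegrable_indicator_split_rpow_neg μ𝔤 (by norm_num : (1 / 8 : ℝ) < 1 / 4)).integrableOn_isCompact hS).const_mul C
  refine Integrable.mono' hdom hm.aestronglyMeasurable ((ae_restrict_iff' hS.isClosed.measurableSet).2 (Eventually.of_forall fun X hX => ?_))
  by_cases hX𝔤 : X ∈ 𝔤'
  · rw [indicator_of_mem hX𝔤, indicator_of_mem hX𝔤]
    have ht : 0 < (normAbs F X.charpoly.discr : ℝ) := NNReal.coe_pos.2 (pos_iff_ne_zero.2 ((map_ne_zero (normAbs F)).2 hX𝔤.1))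
    have h1 : 0 < (normAbs F X.charpoly.discr : ℝ) ^ (-(1 / 2 : ℝ)) := Real.rpow_pos_of_pos ht _
    rw [Real.norm_of_nonneg (mul_nonneg h1.le (by positivity))]
    calc (normAbs F X.charpoly.discr : ℝ) ^ (-(1 / 2 : ℝ)) * (1 + |Real.log (normAbs F X.charpoly.discr : ℝ)|) ^ κ
        ≤ (normAbs F X.charpoly.discr : ℝ) ^ (-(1 / 2 : ℝ)) * (C * (normAbs F X.charpoly.discr : ℝ) ^ (-(1 / 8 : ℝ))) :=
          mul_le_mul_of_nonneg_left (hC _ ht (hle X hX)) h1.le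
      _ = C * (normAbs F X.charpoly.discr : ℝ) ^ (-(1 / 2 + 1 / 8 : ℝ)) := by
          rw [show (-(1 / 2 + 1 / 8 : ℝ)) = -(1 / 2 : ℝ) + -(1 / 8 : ℝ) by ring, Real.rpow_add ht]
          ring
  · rw [indicator_of_notMem hX𝔤, indicator_of_notMem hX𝔤, norm_zero, mul_zero]

end Summit.HodgeConjecture.HodgeConjecture.Cruxes.H413.K2E3GL3SplitDiscriminantLogLocIntegrable

end
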